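import Literature.NumberTheory.GaloisRepresentations.LocalField
import Literature.NumberTheory.Automorphic.AdicCompletionLocalField
import Literature.NumberTheory.Automorphic.QuadraticLocalBaseChange
import Literature.NumberTheory.Automorphic.UnitaryGroupLocalFactors
import Literature.NumberTheory.Automorphic.GaloisActionPlaces
import HarnessLib

/-!
# Local L-factors of characters and the normaliser `a_w(s)` of the Siegel intertwining operator (A-int (A4′), DEFS leaf T1)

Supports lane of hLiu418 = stmt-HodgeConjecture-24832 (`--kind definition`, `--as helper`; RULING M-156i: «FIXED explicit normaliser
`a_w(s) := νN(N_Δ(𝒪_w)) · a_n(s,χ_w)/b_n(s,χ_w)` BY NAME, dead L-factors `:= 1`»).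

* §1 For a finite place `w` of a number field `K`: a chosen uniformizer `ϖ_w` of `K_w`, the predicate `IsUnramifiedChar μ` (a character
  `μ : K_wˣ → ℂˣ` trivial on `𝒪_wˣ`), its Satake value `unramValue μ = μ(ϖ_w)` (`0` if ramified — the «dead factor» convention), and the
  local L-factor `lFactor μ z = (1 − unramValue μ · q_w^{−z})⁻¹` (so `= 1` for ramified `μ`).
* §2 At a place `v` of `F` in the CM/quadratic extension `E/F` with involution `c`, for local components `χ_v = (χ_w)_{w ∣ v}`: the restriction
  `χ_{F,v} = Π_w χ_w ∘ ι_w` to `F_vˣ`, the norm-twist `χ_{F,v} ∘ N_{E_w/F_v} = χ_w · (χ_{cw} ∘ c)` on `E_wˣ`, and the HKS factors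
  `a_n(s,χ) = Π_{j<n} L_F(2s+j−n+1, χ_F η^j)`, `b_n(s,χ) = Π_{j<n} L_F(2s+n−j, χ_F η^j)` written WITHOUT the quadratic character `η = η_{E/F}`
  through the identity `L_F(z, μ)·L_F(z, μη) = Π_{w∣v} L_{E_w}(z, μ ∘ N_{E_w/F_v})` (valid at split, inert and ramified `v`, alive or dead):
  the `j`-th factor is `L_F(z, χ_F)` for even `j` and `Π_w L_{E_w}(z, χ_F∘N) / L_F(z, χ_F)` for odd `j`.
* §3 `aNorm n χ_v vol s = vol · a_n(s,χ_v)/b_n(s,χ_v)` and its closed forms for `n = 1` (`vol · L_F(2s,χ_F)/L_F(2s+1,χ_F)`, the scalar of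
  ★ `K2LiuGKRankOneIdentity`) and `n = 2` (`vol · L_F(2s−1,χ_F) L_F(2s,χ_Fη) / (L_F(2s+2,χ_F) L_F(2s+1,χ_Fη))`, which carries the simple pole
  `ζ_{F_v}(2s−1)` at `s = ½` at places SPLIT in `E` — CENSUS-A4A5 (W2)).
[cite: HarrisKudlaSweet1996, §6 (6.14)–(6.16)] [cite: KudlaSweet1997, §1] [cite: Tan1999, §2] [cite: Casselman1980, §3]
-/

noncomputable section

set_option autoImplicit false
-- the mandated namespace repeats the single-problem summit's segment (`HodgeConjecture.HodgeConjecture`)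
set_option linter.dupNamespace false

open NumberField IsDedekindDomain

namespace Summit.HodgeConjecture.HodgeConjecture.Cruxes.HLiu418.K2LiuLocalLFactorDefs

open Literature.NumberTheory.GaloisRepresentations Literature.NumberTheory.GaloisRepresentations.IsNonarchimedeanLocalField
open Literature.NumberTheory.Automorphic Literature.NumberTheory.Automorphic.UnitaryGroup

/-! ## §1 Uniformizers, unramified characters, local L-factors on `K_w` -/

section LocalField

variable (K : Type) [Field K] [NumberField K] (w : HeightOneSpectrum (𝓞 K))

/-- **A chosen uniformizer `ϖ_w ∈ K_w`** (taken in `K`: Mathlib `valuation_exists_uniformizer`).  Light twin of ★ `GL2LocalSupercuspForm.unif` /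
`valued_unifAt` (same statement; NOT imported here: that module's import closure is the `GL₂` supercuspidal spectrum, too heavy for a defs leaf).
[cite: Casselman1980, §3] -/
def unifAt : w.adicCompletion K :=
  ((Classical.choose (w.valuation_exists_uniformizer K) : K) : w.adicCompletion K)

/-- `|ϖ_w|_w = exp(−1)` (twin of ★ `GL2LocalSupercuspForm.valued_unif`). [cite: Casselman1980, §3] -/
theorem valued_unifAt : Valued.v (unifAt K w) = WithZero.exp (-1 : ℤ) := by
  rw [unifAt, HeightOneSpectrum.valuedAdicCompletion_eq_valuation']
  exact Classical.choose_spec (w.valuation_exists_uniformizer K)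

/-- `ϖ_w ≠ 0`. [cite: Casselman1980, §3] -/
theorem unifAt_ne_zero : unifAt K w ≠ 0 := by
  intro h
  have := valued_unifAt K w
  rw [h, map_zero] at this
  exact WithZero.zero_ne_coe this

/-- `ϖ_w` as a unit of `K_w`. [cite: Casselman1980, §3] -/
def unifAtUnit : (w.adicCompletion K)ˣ := Units.mk0 (unifAt K w) (unifAt_ne_zero K w)

/-- coercion of `unifAtUnit`. [cite: Casselman1980, §3] -/
@[simp] theorem coe_unifAtUnit : (unifAtUnit K w : w.adicCompletion K) = unifAt K w := rfl

variable {K w}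

/-- **`μ` is unramified**: trivial on the units `𝒪_wˣ = {u : |u|_w = 1}`. [cite: Casselman1980, §3] [cite: Tate1950, §2.3] -/
def IsUnramifiedChar (μ : (w.adicCompletion K)ˣ →* ℂˣ) : Prop :=
  ∀ u : (w.adicCompletion K)ˣ, Valued.v (u : w.adicCompletion K) = 1 → μ u = 1

/-- an unramified `μ` takes the same value on elements of the same valuation. [cite: Casselman1980, §3] -/
theorem IsUnramifiedChar.apply_eq_of_valued_eq {μ : (w.adicCompletion K)ˣ →* ℂˣ} (hμ : IsUnramifiedChar μ)
    (u₁ u₂ : (w.adicCompletion K)ˣ) (h : Valued.v (u₁ : w.adicCompletion K) = Valued.v (u₂ : w.adicCompletion K)) : μ u₁ = μ u₂ := by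
  have h2 : Valued.v ((u₂ : (w.adicCompletion K)ˣ) : w.adicCompletion K) ≠ 0 :=
    (Valuation.ne_zero_iff _).2 u₂.ne_zero
  have h1 : Valued.v ((u₁ * u₂⁻¹ : (w.adicCompletion K)ˣ) : w.adicCompletion K) = 1 := by
    rw [Units.val_mul, Units.val_inv_eq_inv_val, map_mul, map_inv₀, h, mul_inv_cancel₀ h2]
  have := hμ _ h1
  rwa [map_mul, map_inv, mul_inv_eq_one] at this

variable (K w)

/-- **The Satake value of `μ`**: `μ(ϖ_w)` if `μ` is unramified, `0` otherwise (the «dead L-factor» convention: `L(z, μ) = 1` for ramified `μ`).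
[cite: HarrisKudlaSweet1996, §6 (6.16)] [cite: Casselman1980, §3] -/
def unramValue (μ : (w.adicCompletion K)ˣ →* ℂˣ) : ℂ := by
  classical
  exact if IsUnramifiedChar μ then ((μ (unifAtUnit K w) : ℂˣ) : ℂ) else 0

/-- ramified ⟹ Satake value `0`. [cite: HarrisKudlaSweet1996, §6 (6.16)] -/
theorem unramValue_of_not {μ : (w.adicCompletion K)ˣ →* ℂˣ} (hμ : ¬ IsUnramifiedChar μ) : unramValue K w μ = 0 := by
  classical
  exact if_neg hμ

/-- unramified ⟹ the Satake value is `μ(ϖ)` for ANY uniformizer `ϖ`. [cite: Casselman1980, §3] -/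
theorem unramValue_eq_apply {μ : (w.adicCompletion K)ˣ →* ℂˣ} (hμ : IsUnramifiedChar μ) {ϖ : w.adicCompletion K}
    (hϖ : Valued.v ϖ = WithZero.exp (-1 : ℤ)) (hϖ0 : ϖ ≠ 0) :
    unramValue K w μ = ((μ (Units.mk0 ϖ hϖ0) : ℂˣ) : ℂ) := by
  classical
  rw [unramValue, if_pos hμ, hμ.apply_eq_of_valued_eq (unifAtUnit K w) (Units.mk0 ϖ hϖ0)
    (by rw [coe_unifAtUnit, Units.val_mk0, valued_unifAt, hϖ])]

/-- the Satake value of an unramified character is non-zero. [cite: Casselman1980, §3] -/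
theorem unramValue_ne_zero {μ : (w.adicCompletion K)ˣ →* ℂˣ} (hμ : IsUnramifiedChar μ) : unramValue K w μ ≠ 0 := by
  classical
  rw [unramValue, if_pos hμ]
  exact (μ (unifAtUnit K w)).ne_zero

/-- the trivial character is unramified, with Satake value `1`. [cite: Casselman1980, §3] -/
theorem unramValue_one : unramValue K w (1 : (w.adicCompletion K)ˣ →* ℂˣ) = 1 := by
  classical
  have h1 : IsUnramifiedChar (1 : (w.adicCompletion K)ˣ →* ℂˣ) := fun u _ => rfl
  rw [unramValue, if_pos h1, MonoidHom.one_apply, Units.val_one]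

/-- **The local L-factor `L(z, μ) = (1 − unramValue μ · q_w^{−z})⁻¹`** of a character `μ` of `K_wˣ` (`q_w` = ★ `residueFieldCard K_w`; equals `1`
for ramified `μ`). [cite: Tate1950, §2.5] [cite: HarrisKudlaSweet1996, §6 (6.16)] -/
def lFactor (μ : (w.adicCompletion K)ˣ →* ℂˣ) (z : ℂ) : ℂ :=
  (1 - unramValue K w μ * (residueFieldCard (w.adicCompletion K) : ℂ) ^ (-z))⁻¹

/-- unfolding of `lFactor`. [cite: Tate1950, §2.5] -/
theorem lFactor_def (μ : (w.adicCompletion K)ˣ →* ℂˣ) (z : ℂ) :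
    lFactor K w μ z = (1 - unramValue K w μ * (residueFieldCard (w.adicCompletion K) : ℂ) ^ (-z))⁻¹ := rfl

/-- dead factor: `L(z, μ) = 1` for ramified `μ`. [cite: HarrisKudlaSweet1996, §6 (6.16)] -/
theorem lFactor_of_not {μ : (w.adicCompletion K)ˣ →* ℂˣ} (hμ : ¬ IsUnramifiedChar μ) (z : ℂ) : lFactor K w μ z = 1 := by
  rw [lFactor_def, unramValue_of_not K w hμ, zero_mul, sub_zero, inv_one]

/-- alive factor: `L(z, μ) = (1 − μ(ϖ) q_w^{−z})⁻¹` for unramified `μ` and any uniformizer `ϖ`. [cite: Tate1950, §2.5] -/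
theorem lFactor_eq_of_unram {μ : (w.adicCompletion K)ˣ →* ℂˣ} (hμ : IsUnramifiedChar μ) {ϖ : w.adicCompletion K}
    (hϖ : Valued.v ϖ = WithZero.exp (-1 : ℤ)) (hϖ0 : ϖ ≠ 0) (z : ℂ) :
    lFactor K w μ z = (1 - ((μ (Units.mk0 ϖ hϖ0) : ℂˣ) : ℂ) * (residueFieldCard (w.adicCompletion K) : ℂ) ^ (-z))⁻¹ := by
  rw [lFactor_def, unramValue_eq_apply K w hμ hϖ hϖ0]

/-- `L(z, 1) = (1 − q_w^{−z})⁻¹ = ζ_{K_w}(z)`. [cite: Tate1950, §2.5] -/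
theorem lFactor_one (z : ℂ) : lFactor K w 1 z = (1 - (residueFieldCard (w.adicCompletion K) : ℂ) ^ (-z))⁻¹ := by
  rw [lFactor_def, unramValue_one, one_mul]

end LocalField

/-! ## §2 At a place `v` of `F` in `E/F`: `χ_{F,v}`, the norm twist, the HKS factors -/

section Quadratic

variable (F : Type) [Field F] [NumberField F] (E : Type) [Field E] [NumberField E] [Algebra F E]
  (c : E ≃ₐ[F] E) (v : HeightOneSpectrum (𝓞 F))

/-- **`χ_{F,v} := χ_v|_{F_vˣ} = Π_{w∣v} χ_w ∘ ι_w`** for local components `χ_v = (χ_w)_{w∣v}` (`ι_w = toPlace v w : F_v → E_w`; `F_vˣ ↪ E_vˣ = Π_w E_wˣ`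
diagonally). [cite: HarrisKudlaSweet1996, §6 (6.14)] [cite: KudlaSweet1997, §1] -/
def chiF (χv : ∀ w : PlacesOver E v, (w.1.adicCompletion E)ˣ →* ℂˣ) : (v.adicCompletion F)ˣ →* ℂˣ where
  toFun x := ∏ w : PlacesOver E v, χv w (Units.map (toPlace v w : v.adicCompletion F →* w.1.adicCompletion E) x)
  map_one' := by simp
  map_mul' x y := by
    rw [← Finset.prod_mul_distrib]
    exact Finset.prod_congr rfl fun w _ => by rw [map_mul, map_mul]

/-- unfolding of `chiF`. [cite: HarrisKudlaSweet1996, §6 (6.14)] -/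
theorem chiF_apply (χv : ∀ w : PlacesOver E v, (w.1.adicCompletion E)ˣ →* ℂˣ) (x : (v.adicCompletion F)ˣ) :
    chiF F E v χv x = ∏ w : PlacesOver E v, χv w (Units.map (toPlace v w : v.adicCompletion F →* w.1.adicCompletion E) x) := rfl

variable {F E v} in
/-- the conjugate place `c • w` over the same `v`. [cite: CasselsFrohlichANT1967, Ch. VII §1.1] -/
def galPlace (w : PlacesOver E v) : PlacesOver E v :=
  ⟨c • w.1, by rw [HeightOneSpectrum.under_algEquiv_smul]; exact w.2⟩

variable {F E v} in
/-- `(galPlace c w).1 = c • w.1`. [cite: CasselsFrohlichANT1967, Ch. VII §1.1] -/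
@[simp] theorem galPlace_val (w : PlacesOver E v) : (galPlace c w).1 = c • w.1 := rfl

/-- **The norm twist `(χ_{F,v} ∘ N_{E_w/F_v})` on `E_wˣ`, written as `χ_w · (χ_{cw} ∘ c_w)`** (`N x = x · c(x)`; at a split `v` this reads
`χ_w · χ_{w̄}` through `E_w ≅ F_v ≅ E_{w̄}`).  Through `L_F(z, μ) L_F(z, μ η_{E/F}) = Π_{w∣v} L_{E_w}(z, μ∘N)` it replaces every `η`-twisted factor.
[cite: HarrisKudlaSweet1996, §6 (6.16)] [cite: Tate1950, §2.5] -/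
def chiNorm (χv : ∀ w : PlacesOver E v, (w.1.adicCompletion E)ˣ →* ℂˣ) (w : PlacesOver E v) : (w.1.adicCompletion E)ˣ →* ℂˣ :=
  (χv w) * (χv (galPlace c w)).comp
    (Units.map ((galAdicCompletionMap (L := E) c (rfl : c • w.1 = (galPlace c w).1)).toMonoidHom :
      w.1.adicCompletion E →* (galPlace c w).1.adicCompletion E))

/-- unfolding of `chiNorm`. [cite: HarrisKudlaSweet1996, §6 (6.16)] -/
theorem chiNorm_apply (χv : ∀ w : PlacesOver E v, (w.1.adicCompletion E)ˣ →* ℂˣ) (w : PlacesOver E v) (x : (w.1.adicCompletion E)ˣ) :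
    chiNorm F E c v χv w x = χv w x * χv (galPlace c w)
      (Units.map ((galAdicCompletionMap (L := E) c (rfl : c • w.1 = (galPlace c w).1)).toMonoidHom :
        w.1.adicCompletion E →* (galPlace c w).1.adicCompletion E) x) :=
  rfl

/-- **`L_F(z, χ_{F,v})`.** [cite: HarrisKudlaSweet1996, §6 (6.16)] -/
def lF (χv : ∀ w : PlacesOver E v, (w.1.adicCompletion E)ˣ →* ℂˣ) (z : ℂ) : ℂ :=
  lFactor F v (chiF F E v χv) z

/-- **`L_{E/F,v}(z, χ_F ∘ N) := Π_{w∣v} L_{E_w}(z, χ_F ∘ N_{E_w/F_v})`** (`= L_F(z, χ_F) · L_F(z, χ_F η)`). [cite: HarrisKudlaSweet1996, §6 (6.16)] -/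
def lEN (χv : ∀ w : PlacesOver E v, (w.1.adicCompletion E)ˣ →* ℂˣ) (z : ℂ) : ℂ :=
  ∏ w : PlacesOver E v, lFactor E w.1 (chiNorm F E c v χv w) z

/-- **The `j`-th Gindikin–Karpelevich factor `L_F(z, χ_F η^j)`**, `η`-free: `L_F(z, χ_F)` for even `j`, `L_{E/F,v}(z, χ_F∘N) / L_F(z, χ_F)` for odd `j`.
[cite: HarrisKudlaSweet1996, §6 (6.16)] [cite: KudlaSweet1997, §1] -/
def gkFactor (χv : ∀ w : PlacesOver E v, (w.1.adicCompletion E)ˣ →* ℂˣ) (j : ℕ) (z : ℂ) : ℂ :=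
  if Even j then lF F E v χv z else lEN F E c v χv z / lF F E v χv z

/-- even index: `gkFactor j z = L_F(z, χ_F)`. [cite: HarrisKudlaSweet1996, §6 (6.16)] -/
theorem gkFactor_of_even (χv : ∀ w : PlacesOver E v, (w.1.adicCompletion E)ˣ →* ℂˣ) {j : ℕ} (hj : Even j) (z : ℂ) :
    gkFactor F E c v χv j z = lF F E v χv z := if_pos hj

/-- odd index: `gkFactor j z = L_{E/F}(z, χ_F∘N) / L_F(z, χ_F)` (`= L_F(z, χ_F η)`). [cite: HarrisKudlaSweet1996, §6 (6.16)] -/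
theorem gkFactor_of_odd (χv : ∀ w : PlacesOver E v, (w.1.adicCompletion E)ˣ →* ℂˣ) {j : ℕ} (hj : Odd j) (z : ℂ) :
    gkFactor F E c v χv j z = lEN F E c v χv z / lF F E v χv z := if_neg (Nat.not_even_iff_odd.2 hj)

/-- **HKS's `a_n(s, χ_v) = Π_{j<n} L_F(2s + j − n + 1, χ_F η^j)`.** [cite: HarrisKudlaSweet1996, §6 (6.16)] [cite: KudlaSweet1997, §1] -/
def aNum (n : ℕ) (χv : ∀ w : PlacesOver E v, (w.1.adicCompletion E)ˣ →* ℂˣ) (s : ℂ) : ℂ :=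
  ∏ j ∈ Finset.range n, gkFactor F E c v χv j (2 * s + (j : ℂ) - (n : ℂ) + 1)

/-- **HKS's `b_n(s, χ_v) = Π_{j<n} L_F(2s + n − j, χ_F η^j)`.** [cite: HarrisKudlaSweet1996, §6 (6.16)] [cite: KudlaSweet1997, §1] -/
def bDen (n : ℕ) (χv : ∀ w : PlacesOver E v, (w.1.adicCompletion E)ˣ →* ℂˣ) (s : ℂ) : ℂ :=
  ∏ j ∈ Finset.range n, gkFactor F E c v χv j (2 * s + (n : ℂ) - (j : ℂ))

/-! ## §3 The normaliser `a_w(s) = νN(N_Δ(𝒪_w)) · a_n/b_n` and its closed forms for `n = 1, 2` -/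

/-- **The normaliser `a_w(s) := vol · a_n(s, χ_v) / b_n(s, χ_v)`** of the local Siegel intertwining operator on `U(n,n)(F_v)` — the spherical value
`M_v(s) φ°_s (1)` at unramified data with `vol = νN(N_Δ(F_v) ∩ K_v)` (★ `K2LiuGKRankOneIdentity` for `n = 1`; Gindikin–Karpelevich), taken as the
Φ-INDEPENDENT normalising factor of (A4′) at every finite place (RULING M-156i).  `vol` is a real PARAMETER (consumers plug `νN.real (N_Δ ∩ K_v)`).
[cite: HarrisKudlaSweet1996, §6 (6.14)–(6.16)] [cite: KudlaSweet1997, §1] [cite: Tan1999, §2] -/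
def aNorm (n : ℕ) (χv : ∀ w : PlacesOver E v, (w.1.adicCompletion E)ˣ →* ℂˣ) (vol : ℝ) (s : ℂ) : ℂ :=
  (vol : ℂ) * (aNum F E c v n χv s / bDen F E c v n χv s)

/-- unfolding of `aNorm`. [cite: HarrisKudlaSweet1996, §6 (6.16)] -/
theorem aNorm_def (n : ℕ) (χv : ∀ w : PlacesOver E v, (w.1.adicCompletion E)ˣ →* ℂˣ) (vol : ℝ) (s : ℂ) :
    aNorm F E c v n χv vol s = (vol : ℂ) * (aNum F E c v n χv s / bDen F E c v n χv s) := rfl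

/-- **`n = 1`: `a_w(s) = vol · L_F(2s, χ_F) / L_F(2s+1, χ_F)`** — the scalar `(1 − t)/(1 − q t)`, `t = χ_F(ϖ) q^{−2s−1}`, of ★ `localIntertwining_eq_rankOne`.
[cite: HarrisKudlaSweet1996, §6 (6.16)] [cite: Casselman1980, §3 Thm. 3.1] -/
theorem aNorm_one (χv : ∀ w : PlacesOver E v, (w.1.adicCompletion E)ˣ →* ℂˣ) (vol : ℝ) (s : ℂ) :
    aNorm F E c v 1 χv vol s = (vol : ℂ) * (lF F E v χv (2 * s) / lF F E v χv (2 * s + 1)) := by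
  rw [aNorm_def, aNum, bDen, Finset.prod_range_one, Finset.prod_range_one, gkFactor_of_even F E c v χv Even.zero,
    gkFactor_of_even F E c v χv Even.zero]
  congr 1
  norm_num

/-- **`n = 2`: `a_w(s) = vol · L_F(2s−1, χ_F) · L_F(2s, χ_Fη) / (L_F(2s+2, χ_F) · L_F(2s+1, χ_Fη))`** with `L_F(z, χ_Fη) = L_{E/F}(z, χ_F∘N)/L_F(z, χ_F)`
— the doubled `U(2,2)` of the curve case; at `v` split in `E` (`χ_F = 1` there) the factor `L_F(2s−1, 1) = ζ_{F_v}(2s−1)` has a simple pole at `s = ½`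
(CENSUS-A4A5 (W2)). [cite: HarrisKudlaSweet1996, §6 (6.16)] [cite: KudlaSweet1997, §1] -/
theorem aNorm_two (χv : ∀ w : PlacesOver E v, (w.1.adicCompletion E)ˣ →* ℂˣ) (vol : ℝ) (s : ℂ) :
    aNorm F E c v 2 χv vol s = (vol : ℂ) *
      ((lF F E v χv (2 * s - 1) * (lEN F E c v χv (2 * s) / lF F E v χv (2 * s))) /
        (lF F E v χv (2 * s + 2) * (lEN F E c v χv (2 * s + 1) / lF F E v χv (2 * s + 1)))) := by
  rw [aNorm_def, aNum, bDen]
  congr 1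
  simp only [Finset.prod_range_succ, Finset.prod_range_zero, one_mul, gkFactor_of_even F E c v χv Even.zero,
    gkFactor_of_odd F E c v χv odd_one]
  norm_num
  ring_nf

end Quadratic

end Summit.HodgeConjecture.HodgeConjecture.Cruxes.HLiu418.K2LiuLocalLFactorDefs

end
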